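import Summits.CriticalPhenomena.PercolationContinuityZ3.Theorems.PercNearOneGluingNoHeavyLowerTailAntiBandMatching
import Summits.CriticalPhenomena.PercolationContinuityZ3.Theorems.PercNearOneGluingNoHeavyLowerTailAntiBandCoveringDet

/-!
# `NoHeavyLowerTail` (crux stmt-CriticalPhenomena-4575), lane prim-ineq-gen-4 (gen 21): THE DETERMINANT CRITERION for the anti-band inequality (AB_l)

Support file (`--supports stmt-CriticalPhenomena-4575`; memo `run/shared/lean/prim/prim-ineq-gen-4/FINDING-DET-CRITERION-g21.md` §1).
No definitions, no `sorry`, standard axioms.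

For an upper set `A` of finsets of `β` with `2l ≤ |β|`, let `U = {x ∈ A | #x < l}` (the small members).  If the binomial matrix
`M_U = [ C(|β| − 1 − #(x ∪ x'), l − 1) ]_{x,x' ∈ U}` has non-zero determinant (over `ℤ`), then (AB_l) holds for `A` and EVERY upper set `V`:
`#{s ∈ A ∩ Vᶜˢ | #s < l ∨ #sᶜ < l} ≤ #{s ∈ A ∩ V | #s < l ∨ #sᶜ < l}`.
Proof: the outer part `W' = {s ∈ A | #s < l ∨ #sᶜ < l}` is `U ⊔ {dᶜ : d ∈ D}` with `D = {d | #d < l, dᶜ ∈ A}` a lower set containing every small set disjoint from a member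
of `U`; re-indexing the covering matrix `[s ∪ t = univ]` of `W'` along `W' ≃ U ⊕ D` gives the block matrix of `AntiBandCoveringDet`, whose determinant is non-zero iff
`det M_U ≠ 0`; a non-zero determinant yields a covering permutation and hence (AB_l) (`AntiBandMatching`).  With Lemma 1 of gen 20 (`AntiBandShift`: opposite compressions
do not increase the anti-band functional) this reduces (AB_l)(y) for ALL pairs of up-sets to `det M_U ≠ 0` for the left-shifted up-closed families `U` of the ball —
verified by computer for (y,l) ≤ (10,4) and conjectured in general (memo §3, "parity-inertia conjecture").
-/

namespace Summit.CriticalPhenomena.PercolationContinuityZ3.Theorems.AntiBandDetCriterion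

open Finset Matrix
open scoped FinsetFamily

variable {β : Type*} [DecidableEq β] [Fintype β]

omit [Fintype β] in
/-- `s ∪ tᶜ = univ ↔ t ⊆ s` for finsets of a fintype. [elementary] -/
theorem union_compl_eq_univ_iff [Fintype β] (s t : Finset β) : s ∪ tᶜ = univ ↔ t ⊆ s := by
  constructor
  · intro h a ha
    have hau : a ∈ s ∪ tᶜ := by rw [h]; exact mem_univ a
    rcases mem_union.1 hau with h1 | h2
    · exact h1
    · exact absurd ha (mem_compl.1 h2)
  · intro h
    ext a
    simp only [mem_union, mem_compl, mem_univ, iff_true]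
    by_cases ha : a ∈ t
    · exact Or.inl (h ha)
    · exact Or.inr ha

/-- **Determinant criterion for (AB_l).**  Let `A` be an upper set of finsets of `β`, `1 ≤ l`, `2l ≤ |β|`, and `U = {x ∈ A | #x < l}`.  If
`det [ C(|β|−1−#(x∪x'), l−1) ]_{x,x'∈U} ≠ 0`, then for every upper set `V`: `#{s ∈ A ∩ Vᶜˢ | #s < l ∨ #sᶜ < l} ≤ #{s ∈ A ∩ V | #s < l ∨ #sᶜ < l}`.
[gen 21, FINDING-DET-CRITERION-g21.md §1; uses `AntiBandCoveringDet` and `AntiBandMatching`] -/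
theorem antiBand_of_det_binomial_ne_zero (l : ℕ) (hl : 1 ≤ l) (A V : Finset (Finset β))
    (hA : IsUpperSet (A : Set (Finset β))) (hV : IsUpperSet (V : Set (Finset β))) (hβ : 2 * l ≤ Fintype.card β)
    (hdet : (Matrix.of fun (x x' : ↥(A.filter fun s => #s < l)) =>
      ((Fintype.card β - 1 - #((x : Finset β) ∪ x')).choose (l - 1) : ℤ)).det ≠ 0) :
    #((A ∩ Vᶜˢ).filter fun s => #s < l ∨ #sᶜ < l) ≤ #((A ∩ V).filter fun s => #s < l ∨ #sᶜ < l) := by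
  classical
  -- the small members `U` and the lower set `D`
  set U : Finset (Finset β) := A.filter (fun s => #s < l) with hUdef
  set D : Finset (Finset β) := univ.filter (fun d => #d < l ∧ dᶜ ∈ A) with hDdef
  set W' : Finset (Finset β) := A.filter (fun s => #s < l ∨ #sᶜ < l) with hW'def
  have hk : 2 * (l - 1) + 2 ≤ Fintype.card β := by omega
  have hDlow : IsLowerSet (D : Set (Finset β)) := by
    intro a b hba ha
    rw [Finset.mem_coe, hDdef, mem_filter] at ha ⊢
    refine ⟨mem_univ _, lt_of_le_of_lt (card_le_card hba) ha.2.1, ?_⟩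
    exact hA (compl_subset_compl.2 hba) ha.2.2
  have hDk : ∀ d ∈ D, #d ≤ l - 1 := by
    intro d hd; rw [hDdef, mem_filter] at hd; omega
  have hUk : ∀ x ∈ U, #x ≤ l - 1 := by
    intro x hx; rw [hUdef, mem_filter] at hx; omega
  have hsh : ∀ u : Finset β, #u ≤ l - 1 → ∀ x ∈ U, Disjoint u x → u ∈ D := by
    intro u hu x hx hux
    rw [hUdef, mem_filter] at hx
    rw [hDdef, mem_filter]
    refine ⟨mem_univ _, by omega, ?_⟩
    have hxu : x ⊆ uᶜ := Finset.subset_compl_iff_disjoint_right.2 hux.symm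
    exact hA hxu hx.1
  -- the covering matrix of the outer part, re-indexed along `W' ≃ U ⊕ D`
  have hnot : ∀ s : Finset β, #s < l → ¬ #sᶜ < l := by
    intro s hs hsc; rw [Finset.card_compl] at hsc; omega
  let e : ↥W' ≃ ↥U ⊕ ↥D :=
    { toFun := fun s =>
        if h : #(s : Finset β) < l then Sum.inl ⟨s, Finset.mem_filter.2 ⟨(Finset.mem_filter.1 s.2).1, h⟩⟩
        else Sum.inr ⟨(s : Finset β)ᶜ, Finset.mem_filter.2 ⟨mem_univ _, (Finset.mem_filter.1 s.2).2.resolve_left h, by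
            rw [compl_compl]; exact (Finset.mem_filter.1 s.2).1⟩⟩
      invFun := fun z => match z with
        | Sum.inl x => ⟨x, Finset.mem_filter.2 ⟨(Finset.mem_filter.1 x.2).1, Or.inl (Finset.mem_filter.1 x.2).2⟩⟩
        | Sum.inr d => ⟨(d : Finset β)ᶜ, Finset.mem_filter.2 ⟨(Finset.mem_filter.1 d.2).2.2, Or.inr (by
            rw [compl_compl]; exact (Finset.mem_filter.1 d.2).2.1)⟩⟩
      left_inv := by
        intro s
        by_cases h : #(s : Finset β) < l
        · simp [h]
        · apply Subtype.ext
          simp [h]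
      right_inv := by
        intro z
        rcases z with x | d
        · have hx := (Finset.mem_filter.1 x.2).2
          simp [hx]
        · have hd := (Finset.mem_filter.1 d.2).2.1
          have h : ¬ #((d : Finset β)ᶜ) < l := by rw [Finset.card_compl]; omega
          simp only [h, dif_neg, not_false_eq_true]
          congr 1
          apply Subtype.ext
          simp }
  have hCW : Matrix.reindex e e (Matrix.of fun (i j : ↥W') => if (i : Finset β) ∪ (j : Finset β) = univ then (1 : ℤ) else 0)
      = Matrix.fromBlocks (0 : Matrix ↥U ↥U ℤ)
          (Matrix.of fun (x : ↥U) (d : ↥D) => if (d : Finset β) ⊆ x then (1 : ℤ) else 0)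
          (Matrix.of fun (d : ↥D) (x : ↥U) => if (d : Finset β) ⊆ x then (1 : ℤ) else 0)
          (Matrix.of fun (d d' : ↥D) => if Disjoint (d : Finset β) d' then (1 : ℤ) else 0) := by
    ext i j
    rw [Matrix.reindex_apply, Matrix.submatrix_apply, Matrix.of_apply]
    rcases i with x | d <;> rcases j with x' | d'
    · -- two small sets never cover `univ`
      rw [Matrix.fromBlocks_apply₁₁, Matrix.zero_apply]
      have hx := (Finset.mem_filter.1 x.2).2
      have hx' := (Finset.mem_filter.1 x'.2).2
      have hne : (x : Finset β) ∪ (x' : Finset β) ≠ univ := by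
        intro h
        have h1 := congrArg Finset.card h
        rw [Finset.card_univ] at h1
        have h2 := Finset.card_union_le (x : Finset β) (x' : Finset β)
        omega
      simp [e, hne]
    · rw [Matrix.fromBlocks_apply₁₂, Matrix.of_apply]
      simp [e, union_compl_eq_univ_iff]
    · rw [Matrix.fromBlocks_apply₂₁, Matrix.of_apply]
      simp [e, Finset.union_comm ((d : Finset β)ᶜ), union_compl_eq_univ_iff]
    · rw [Matrix.fromBlocks_apply₂₂, Matrix.of_apply]
      simp [e, ← Finset.compl_inter, Finset.disjoint_iff_inter_eq_empty]
  -- assemble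
  apply AntiBandMatching.antiBand_of_det_ne_zero l A V hV
  have hblocks := AntiBandCoveringDet.det_coveringBlocks_ne_zero_of_det_binomial_ne_zero (l - 1) U D hDlow hDk hsh hUk hk hdet
  rw [← hCW, Matrix.det_reindex_self] at hblocks
  exact hblocks

end Summit.CriticalPhenomena.PercolationContinuityZ3.Theorems.AntiBandDetCriterion
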